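import Summits.RiemannHypothesis.RiemannHypothesis.Theorems.Splittings.NbBurnolFloorRunsEval
import Summits.RiemannHypothesis.RiemannHypothesis.Theorems.Splittings.NbLevelCertificate
import HarnessLib

/-!
# RiemannHypothesis / Nyman–Beurling splittings — the `θ = ½` doubling tail is FALSE for every threshold `H ≤ 47`

Cell `pub/rh-split`, class (nb, neg), gen 8 (card `cards/SPLIT-nb-neg.md` §14, census row V22).  With
`D(N) = inf_a ∫ |1 − ζ(½+it) Σ_{n<N} a_n (n+1)^{−(½+it)}|² dt/(¼+t²)` (`= 2π d_N²`, Báez-Duarte's distance) the doubling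
(self-improvement) tail `TailDoubling(θ, H) : ∀ N ≥ H, D(N²) ≤ θ·D(N)` is, in the tree: REFUTED for every `θ < ½`
(`CostumeDetectorsNbNeg.not_nb_doublingTail_of_lt_half`), RH for every `θ < 1` (`rh_of_nb_doublingTail`), and at
`θ = ½` REDUCED to one finite certificate (`NbHalfDoubling.not_nb_halfDoublingTail_of_certificate`, gen 3: a level
`N₀ ≥ max(H,2)` with `D(N₀)·log N₀ ≤ c` strictly below a certified Burnol floor) and left «UNDECIDED in kernel … two orders of
magnitude beyond the tree's validated numerics».  It is decided here, for `H ≤ 47`: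

* the floor: `0.28855` (`NbBurnolFloorRunsEval.not_nb_halfDoublingTail_of_certificate_em`: 2000 Odlyzko–te Riele brackets +
  10142 Euler–Maclaurin sign-run zeros; computational certificates evaluated by `native_decide`);
* the level: `D(47)·log 47 ≤ 2π d²(ỹ₄₇) log 47 = 0.28752 < 0.28855` (`NbLevelCertificate.levelConst_lt`,
  `level_lintegral_le`: Mellin–Plancherel dictionary + tier-47 Gram table, `decide +kernel`, standard axioms).

`not_nb_halfDoublingTail : H ≤ 47 → ¬ TailDoubling(½, H)`.  Reach: `N₀ = 47` is the largest level the floor `0.28855`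
admits (`2π log N · d_N² = 0.28880` at `N = 48` and `> 0.290` for `49 ≤ N ≤ 52`); thresholds `H ≥ 48` stay undecided.
The axiom closure of the theorem is that of the floor file (the `native_decide` companions of the zero certificates);
everything contributed by the level side is `propext`/`Classical.choice`/`Quot.sound`.

LABEL: `TailDoubling(½, H)` was RH-OR-STRONGER (every `θ < 1` tail gives RH); its refutation for `H ≤ 47` is an RH-free
THEOREM about 47-term Dirichlet polynomials and 12142 certified zeros, NOT a statement about RH.  HONEST LABEL: «SPLITTING
SEARCH over kernel-typed RH-EQUIVALENCES; a splitting A ∧ B ⟹ RH is CONDITIONAL bookkeeping unless A and B are both proved;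
nothing here bears on the truth of RH.»

A computational companion, `Splittings/NbHalfDoublingRefutedEval.lean`, pushes the threshold to `H ≤ 331` with one
`native_decide` level row at tier 331 (the generic checker `NbLevelCertificate.levelCheckAt` makes further levels data-only).
-/

set_option linter.dupNamespace false

namespace Summit.RiemannHypothesis.RiemannHypothesis.Theorems.Splittings.NbHalfDoublingRefuted

open Complex MeasureTheory
open Summit.RiemannHypothesis.RiemannHypothesis.Theorems.NbTheory
open Summit.RiemannHypothesis.RiemannHypothesis.Theorems.Splittings

/-- **The `θ = ½` doubling tail is false for every threshold `H ≤ 47`**: it is not the case that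
`D(N²) ≤ ½·D(N)` for all `N ≥ H`.  (Floor `0.28855` of `NbBurnolFloorRunsEval` × level certificate `N₀ = 47` of
`NbLevelCertificate`, through the gen-3 reduction `not_nb_halfDoublingTail_of_certificate`.) -/
theorem not_nb_halfDoublingTail {H : ℕ} (hH : H ≤ 47) :
    ¬ ∀ N : ℕ, H ≤ N →
      (⨅ a : Fin (N ^ 2) → ℂ, ∫ t : ℝ, ‖1 - riemannZeta (1 / 2 + t * I) *
        ∑ n : Fin (N ^ 2), a n * ((n : ℂ) + 1) ^ (-(1 / 2 + t * I))‖ ^ 2 / (1 / 4 + t ^ 2)) ≤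
      1 / 2 * (⨅ a : Fin N → ℂ, ∫ t : ℝ, ‖1 - riemannZeta (1 / 2 + t * I) *
        ∑ n : Fin N, a n * ((n : ℂ) + 1) ^ (-(1 / 2 + t * I))‖ ^ 2 / (1 / 4 + t ^ 2)) :=
  NbBurnolFloorRuns.not_nb_halfDoublingTail_of_certificate_em hH (by norm_num) NbLevelCertificate.levelConst_lt
    (fun n ↦ -((NbKernel.trial NbLevelCertificate.cert47 47 n : ℝ) : ℂ)) NbLevelCertificate.level_lintegral_le

/-- The strongest instance: the tail from `H = 47` on (hence from every smaller threshold) fails. -/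
theorem not_nb_halfDoublingTail_47 :
    ¬ ∀ N : ℕ, 47 ≤ N →
      (⨅ a : Fin (N ^ 2) → ℂ, ∫ t : ℝ, ‖1 - riemannZeta (1 / 2 + t * I) *
        ∑ n : Fin (N ^ 2), a n * ((n : ℂ) + 1) ^ (-(1 / 2 + t * I))‖ ^ 2 / (1 / 4 + t ^ 2)) ≤
      1 / 2 * (⨅ a : Fin N → ℂ, ∫ t : ℝ, ‖1 - riemannZeta (1 / 2 + t * I) *
        ∑ n : Fin N, a n * ((n : ℂ) + 1) ^ (-(1 / 2 + t * I))‖ ^ 2 / (1 / 4 + t ^ 2)) :=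
  not_nb_halfDoublingTail le_rfl

/-- Equivalently: for every `H ≤ 47` some level `N ≥ H` violates the halving step, `D(N²) > ½·D(N)`. -/
theorem exists_halfDoubling_violation {H : ℕ} (hH : H ≤ 47) :
    ∃ N : ℕ, H ≤ N ∧
      1 / 2 * (⨅ a : Fin N → ℂ, ∫ t : ℝ, ‖1 - riemannZeta (1 / 2 + t * I) *
        ∑ n : Fin N, a n * ((n : ℂ) + 1) ^ (-(1 / 2 + t * I))‖ ^ 2 / (1 / 4 + t ^ 2)) <
      (⨅ a : Fin (N ^ 2) → ℂ, ∫ t : ℝ, ‖1 - riemannZeta (1 / 2 + t * I) *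
        ∑ n : Fin (N ^ 2), a n * ((n : ℂ) + 1) ^ (-(1 / 2 + t * I))‖ ^ 2 / (1 / 4 + t ^ 2)) := by
  by_contra h
  refine not_nb_halfDoublingTail hH fun N hN ↦ ?_
  exact not_lt.mp fun hlt ↦ h ⟨N, hN, hlt⟩

end Summit.RiemannHypothesis.RiemannHypothesis.Theorems.Splittings.NbHalfDoublingRefuted
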